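/-
Copyright: harness21 operator infrastructure (2026). Not a cell file; not a gate target (HarnessLib/ is outside the
proposal layout and is maintained by direct operator commits).
-/
import Lean.LibrarySuggestions.Basic

/-!
# Build-lane export guard for crux workfiles (`Cruxes` name component) — coordinator GO 2026-09-02

Companion of `HarnessLib.LibrarySuggestionsDenyList` (`HodgeCM`) and
`HarnessLib.Audit.LibrarySuggestionsDenyListCorCM` / `…EtaleTheta` / `…Frobenioids`; see the CorCM file for the
mechanism and why these companions live under `HarnessLib/Audit/` (kept out of the regenerated `HarnessLib.lean`
aggregator ⇒ importing this file rebuilds only the importer's own downstream).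

Evidence (2026-09-02, HodgeCM→Mathlib cell, director g30 req547 / LA3-p03 memo): the module
`Summits.HodgeConjecture.HodgeConjecture.Cruxes.HLiu418.Lines.F0_P6a_StubDOWN` (ED. 4, 1 966 lines, 65 theorems in
`namespace Summit.HodgeConjecture.HodgeConjecture.Cruxes.HLiu418.F0P6aStubDOWN`) check-elaborates in 510–1 069 s but its
`lake build` was killed by the 5 400 s no-output stall guard three times; a stack sample of the live build showed the
main thread inside `Lean.LibrarySuggestions.symbolFrequencyExt` export → `localSymbolFrequencyMap` →
`Expr.FoldRelevantConstantsImpl.fold` (heartbeat-unbounded, single core), i.e. after elaboration, during `.olean`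
export. Sibling crux workfiles show the same lake/check ratio (e.g. `…F0_P6a_SpecOrgans` 1 029 s lake vs ≈ 330 s check).
Declarations in crux workfiles across all summits carry the name component `Cruxes`
(`Summit.<Summit>.<Summit>.Cruxes.…`), which none of the existing deny-list entries match.

The single entry below adds the name component `Cruxes` to the library-suggestion premise deny list. Effect: premise
*suggestion* indexing skips those constants at export time. Nothing else changes — no statement, proof, attribute,
reducibility setting or option is touched. Cells opt in by adding
`import HarnessLib.Audit.LibrarySuggestionsDenyListCruxes` to a cone root through the gate.
-/

run_cmd Lean.modifyEnv (Lean.LibrarySuggestions.nameDenyListExt.addEntry · "Cruxes")
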